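/-
Copyright (c) 2026 the pub-hodgecm-mathlib formalisation cell (harness21).  Prover seat hodgecm-mathlib-F0P2-p06 (g11), 2026-09-01, over the SPEC (statement-first)
`F0/P3/A-p19/g26/RamifiedQuadraticDictionary.statementfirst.A-p19g26.lean` (94365e3270ba7246) of the R2² holder A-p19 (g26): T3′ P-2 row (R2²) «THE FREE ROW, TYPE (2)»,
organ [T2-L] «THE RAMIFIED QUADRATIC DICTIONARY AT A PLACE» (road «S3-tree», architect A-p16 (g30) A-137, crux H413).
-/
import Literature.NumberTheory.NumberFields.QuadraticCompletionIntegralBasis          -- ★ LQC Q5 (+ Q4-inert)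
import Literature.NumberTheory.NumberFields.QuadraticCompletionEquivAdjoinRoot        -- ★ LQC Q1 `exists_ringEquiv_adjoinRoot_X_sq_sub_C`
import Literature.NumberTheory.NumberFields.QuadraticRamifiedAtOddValuationPlace      -- ★ LQC Q4-ram + Q3
import Literature.NumberTheory.Automorphic.Liu2021.LemD1AsPrintedIndexedNonVacuityRamifiedPlace  -- ★ `ramificationIdx'_eq_two_of_ne_one`
import Literature.NumberTheory.LocalFields.UnramifiedQuadraticNormAtInertPlace        -- ★ `exists_mul_map_eq_of_isUnit_integer`
import HarnessLib

/-!
# The ramified quadratic dictionary at a place: `θ = √d`, the Eisenstein coordinates of `K₁ = E_w` over `F_v`, the two involutions `s̃ ∕ ι′` of `K₁`, and unit norms for `s̃`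

Topic `NumberTheory/NumberFields`; namespace `Literature.NumberTheory.NumberFields`.  THEOREMS ONLY (no definition, no instance, no notation, no named fact, no `sorry`); kernel lane
`--supports stmt-HodgeConjecture-24833`.  Cell `pub/hodgecm-mathlib` (D-0151), crux H413; road «S3-tree», brick T3′ «depth-zero κ-transfer», P-2 row (R2²) «THE FREE ROW, TYPE (2)»
(holder A-p19 (g26); architect A-p16 (g30) A-106∕A-110∕A-137), organ **[T2-L] «THE RAMIFIED QUADRATIC DICTIONARY AT A PLACE»** = the SPEC `RamifiedQuadraticDictionary.statementfirst`
(A-p19 (g26), 94365e3270ba7246) PROVED, statements token for token (section hypotheses `include`d per theorem exactly as each proof uses them: (L1)(L2) take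
`σ hσδ hδ hm hd hdm`, (L3) takes none; `h2` is never needed — `m` is GIVEN in the square class of `d`, so ★ Q3 is not invoked).  HONEST LABEL: HC_CM is proved only modulo the 2
remaining named inputs (hLiu418 24832, h413 24833) until rung 0 closes; unconditional local algebra, count-neutral.

THE SETTING.  `E ∕ F` a quadratic extension of number fields (`δ² = m`, `σ δ = −δ`, `δ ≠ 0`), `v` a finite place of `F`, `d ∈ F_v` a UNIFORMISER (`|d|_v = exp(−1)`) with
`d⁻¹ m ∈ (F_v^×)²`; then `|m|_v` is odd (★ `exists_valued_eq_exp_odd_of_isSquare_inv_mul`), so `v` is non-split and RAMIFIED in `E` with `e(w|v) = 2` (★ `ramifiedPlace_currency_of_valued_eq_exp_odd`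
∘ ★ `ramificationIdx'_eq_two_of_ne_one`), and `E_w = F_v(√d)` (★ Q1).  Writing `K₁ := E_w`, `ι₁ := toPlace v w`:
* (L1) **`exists_sqrt_and_coord_of_ramified`** — `∃ θ ∈ K₁`, `θ² = ι₁ d`, `|θ|_w = exp(−1)` (★ Q5 `valued_eq_exp_neg_one_of_sq_eq_toPlace`), every `z` is uniquely `ι₁ p + ι₁ q θ` (★ Q5 §3),
  and `ι₁ p + ι₁ q θ ∈ 𝒪[K₁] ↔ p, q ∈ 𝒪[F_v]` (★ Q5 §1 Eisenstein basis);
* (L2) **`exists_involutions_of_ramified`** — an involution `s` of `F_v` with `s d = d`, `s 𝒪 ⊆ 𝒪`, extends to `s̃ : K₁ →+* K₁` over `s` with `s̃ θ = θ`, `s̃ s̃ = id`, `s̃ 𝒪 ⊆ 𝒪`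
  (`s̃ := AdjoinRoot.lift (ι₁ ∘ s) θ ∘ e⁻¹` for the isomorphism `e := AdjoinRoot.lift ι₁ θ : F_v[X]⁄(X² − d) ≃ K₁`), and the `F_v`-linear involution `ι′` has `ι′ θ = −θ`
  (`ι′ := AdjoinRoot.lift ι₁ (−θ) ∘ e⁻¹`); involutivity and `𝒪`-stability are read in the coordinates of (L1);
* (L3) **`exists_mul_map_eq_of_ramified`** — if `s` moves some integer `a` of `F_v` by a unit, every `s̃`-fixed unit of `𝒪[K₁]` is a norm `t · s̃ t` (★
  `exists_mul_map_eq_of_isUnit_integer` on `(K₁, s̃)`: `s̃` moves the integer `ι₁ a` by the unit `ι₁ (s a − a)` — `K₁ ∕ K₁^{s̃}` is UNRAMIFIED).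
Consumed by A-p19 (g26)'s `QuadraticRamifiedOrderNormIndex.relIndex_units_comap_norm_eq` (hypotheses `hcoord`, `hσ₁j`, `hσ₁θ`, `hnorm₁`) at `F := L` (CM), `v := w_L` inert over `L⁺`,
`s := galAdicCompletionMap c`.

* §0 `not_isSquare_of_valued_eq_exp_neg_one`, `ramificationIdx'_eq_two_of_uniformizer`, `toPlace_mem_integer_of_mem_integer`, `exists_ringEquiv_adjoinRoot_of_sq_eq`.
* §1 (L1).  §2 (L2).  §3 (L3).

## References
* [SerreLocalFields1979] J.-P. Serre, *Local Fields*, GTM 67 (1979): Ch. I §6 Prop. 17–18 (Eisenstein basis of a totally ramified extension), Ch. V §2 Prop. 3 and Corollary (unit norms).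
* [Neukirch1999] J. Neukirch, *Algebraic Number Theory*, Grundlehren 322 (1999): Ch. II (8.2)–(8.3), Ch. II §6–§7.
* [Lang2002] S. Lang, *Algebra*, GTM 211 (2002): Ch. V §1 (the universal property of `K[X]⁄(f)`).
* [CasselsFrohlich1967] J. W. S. Cassels, A. Fröhlich (eds.), *Algebraic Number Theory* (1967): Ch. II §10 (completions in extensions).
-/

set_option autoImplicit false

noncomputable section

open NumberField IsDedekindDomain Polynomial
open scoped ValuativeRel
open Literature.NumberTheory.Automorphic Literature.NumberTheory.Automorphic.UnitaryGroup

namespace Literature.NumberTheory.NumberFields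

variable {F : Type} (E : Type) [Field F] [NumberField F] [Field E] [NumberField E] [Algebra F E] [Algebra.IsQuadraticExtension F E]
  (v : HeightOneSpectrum (𝓞 F)) (σ : E ≃ₐ[F] E) {δ : E} (hσδ : σ δ = -δ) (hδ : δ ≠ 0) {m : F} (hm : algebraMap F E m = δ ^ 2)
  {d : v.adicCompletion F} (hd : Valued.v d = WithZero.exp (-1 : ℤ)) (hdm : IsSquare (d⁻¹ * (m : v.adicCompletion F)))
  (h2 : Valued.v (2 : v.adicCompletion F) = 1) (w : PlacesOver E v)

/-! ## §0 Preliminaries: a uniformiser is a non-square; `e(w|v) = 2`; `ι₁ 𝒪 ⊆ 𝒪`; the isomorphism `F_v[X]⁄(X² − d) ≃ E_w` through a GIVEN square root -/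

include hd in
omit [NumberField E] [Algebra F E] [Algebra.IsQuadraticExtension F E] in
/-- A uniformiser (`|d|_v = exp(−1) = exp(2·(−1)+1)`) is not a square. [cite: SerreLocalFields1979, Ch. I §4] -/
theorem not_isSquare_of_valued_eq_exp_neg_one : ¬ IsSquare d :=
  not_isSquare_of_valued_eq_exp_odd (-1) (by rw [hd]; norm_num)

include hσδ hδ hm hd hdm in
/-- **`e(w|v) = 2`** when `d⁻¹ m` is a square for a uniformiser `d`: `|m|_v` is odd (★ `exists_valued_eq_exp_odd_of_isSquare_inv_mul`), so `(σ ≠ 1, σ • w = w, e ≠ 1)` (★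
`ramifiedPlace_currency_of_valued_eq_exp_odd`) and `e = 2` (★ `ramificationIdx'_eq_two_of_ne_one`). [cite: Neukirch1999, Ch. II §8] [cite: SerreLocalFields1979, Ch. I §6] -/
theorem ramificationIdx'_eq_two_of_uniformizer : v.asIdeal.ramificationIdx' w.1.asIdeal = 2 := by
  have hm0 : (m : v.adicCompletion F) ≠ 0 := by
    intro h0
    have hm0 : m = 0 := (map_eq_zero_iff _ (algebraMap F (v.adicCompletion F)).injective).1 h0
    rw [hm0, map_zero] at hm
    exact hδ (pow_eq_zero_iff two_ne_zero |>.1 hm.symm)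
  obtain ⟨k, hk⟩ := exists_valued_eq_exp_odd_of_isSquare_inv_mul (-1) (by rw [hd]; norm_num) hdm hm0
  obtain ⟨hc, hw, he⟩ := ramifiedPlace_currency_of_valued_eq_exp_odd E v σ hσδ hδ hm k hk w
  exact Liu2021.LemD1IndexedNonVacuityRamifiedPlace.ramificationIdx'_eq_two_of_ne_one E v σ hc w hw he

omit [Algebra.IsQuadraticExtension F E] in
/-- `ι₁ = toPlace v w` maps `𝒪[F_v]` into `𝒪[E_w]` (`|ι₁ y|_w = |y|_v ^ e ≤ 1`, ★ `valued_toPlace`). [cite: CasselsFrohlich1967, Ch. II §10] -/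
theorem toPlace_mem_integer_of_mem_integer {y : v.adicCompletion F} (hy : y ∈ 𝒪[v.adicCompletion F]) : toPlace v w y ∈ 𝒪[w.1.adicCompletion E] := by
  rw [mem_integer_iff_valued_le_one] at hy ⊢
  rw [valued_toPlace]
  exact pow_le_one₀ zero_le hy

include hσδ hδ hm hd hdm in
/-- **`F_v[X]⁄(X² − d) ≃ E_w` THROUGH A GIVEN SQUARE ROOT**: for ANY `θ ∈ E_w` with `θ² = ι₁ d` the lift `AdjoinRoot.lift ι₁ θ` is a ring isomorphism `e` with `e ∘ of = ι₁` and
`e(root) = θ` (injective: the source is a field as `X² − d` is irreducible, ★ (QM); surjective: coordinates ★ Q5 §3). [cite: Lang2002, Ch. V §1] [cite: Neukirch1999, Ch. II (8.2)–(8.3)] -/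
theorem exists_ringEquiv_adjoinRoot_of_sq_eq {θ : w.1.adicCompletion E} (hθ : θ ^ 2 = toPlace v w d) :
    ∃ e : AdjoinRoot (X ^ 2 - C d) ≃+* w.1.adicCompletion E,
      (∀ a : v.adicCompletion F, e (AdjoinRoot.of (X ^ 2 - C d) a) = toPlace v w a) ∧ e (AdjoinRoot.root (X ^ 2 - C d)) = θ := by
  have hns : ¬ IsSquare d := not_isSquare_of_valued_eq_exp_neg_one v hd
  have hroot : (X ^ 2 - C d).eval₂ (toPlace v w) θ = 0 := by
    rw [eval₂_sub, eval₂_X_pow, eval₂_C, hθ, sub_self]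
  let φ : AdjoinRoot (X ^ 2 - C d) →+* w.1.adicCompletion E := AdjoinRoot.lift (toPlace v w) θ hroot
  haveI : Fact (Irreducible (X ^ 2 - C d)) := ⟨irreducible_X_sq_sub_C_of_not_isSquare d hns⟩
  have hinj : Function.Injective φ := φ.injective
  have hsurj : Function.Surjective φ := by
    intro z
    obtain ⟨pq, hpq, -⟩ := existsUnique_eq_toPlace_add_toPlace_mul_of_sq_eq E v σ hσδ hδ hm hns hdm w hθ z
    refine ⟨AdjoinRoot.of _ pq.1 + AdjoinRoot.of _ pq.2 * AdjoinRoot.root _, ?_⟩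
    rw [map_add, map_mul, AdjoinRoot.lift_of, AdjoinRoot.lift_of, AdjoinRoot.lift_root, hpq]
  refine ⟨RingEquiv.ofBijective φ ⟨hinj, hsurj⟩, fun a => ?_, ?_⟩
  · exact AdjoinRoot.lift_of hroot
  · exact AdjoinRoot.lift_root hroot

/-! ## §1 (L1) `θ = √d` and the Eisenstein coordinates of `K₁ = E_w` over `F_v` -/

include hσδ hδ hm hd hdm in
/-- **(L1) `θ = √d` AND THE EISENSTEIN COORDINATES OF `K₁ = E_w` OVER `F_v`.** [cite: SerreLocalFields1979, Ch. I §6 Prop. 17–18] [cite: Neukirch1999, Ch. II (8.2)–(8.3)] -/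
theorem exists_sqrt_and_coord_of_ramified :
    ∃ θ : w.1.adicCompletion E, θ ^ 2 = toPlace v w d ∧ Valued.v θ = WithZero.exp (-1 : ℤ) ∧
      (∀ z : w.1.adicCompletion E, ∃! pq : v.adicCompletion F × v.adicCompletion F, z = toPlace v w pq.1 + toPlace v w pq.2 * θ) ∧
      (∀ p q : v.adicCompletion F, toPlace v w p + toPlace v w q * θ ∈ 𝒪[w.1.adicCompletion E] ↔ p ∈ 𝒪[v.adicCompletion F] ∧ q ∈ 𝒪[v.adicCompletion F]) := by
  have hns : ¬ IsSquare d := not_isSquare_of_valued_eq_exp_neg_one v hd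
  have he : v.asIdeal.ramificationIdx' w.1.asIdeal = 2 := ramificationIdx'_eq_two_of_uniformizer E v σ hσδ hδ hm hd hdm w
  obtain ⟨e, -, he_root⟩ := exists_ringEquiv_adjoinRoot_X_sq_sub_C E v σ hσδ hδ hm hns hdm w
  have hθv : Valued.v (e (AdjoinRoot.root (X ^ 2 - C d))) = WithZero.exp (-1 : ℤ) := valued_eq_exp_neg_one_of_sq_eq_toPlace E v w he he_root hd
  refine ⟨e (AdjoinRoot.root (X ^ 2 - C d)), he_root, hθv,
    fun z => existsUnique_eq_toPlace_add_toPlace_mul_of_sq_eq E v σ hσδ hδ hm hns hdm w he_root z, fun p q => ?_⟩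
  rw [toPlace_add_toPlace_mul_mem_integer_iff_of_ramified E v w he hθv, mem_integer_iff_valued_le_one, mem_integer_iff_valued_le_one]

/-! ## §2 (L2) The two involutions of `K₁ = F_v(θ)` -/

include hσδ hδ hm hd hdm in
/-- **(L2) THE TWO INVOLUTIONS OF `K₁ = F_v(θ)`**: an involution `s` of `F_v` fixing `d` (and preserving `𝒪`) extends to `s̃ : K₁ →+* K₁` with `s̃ θ = θ` (`AdjoinRoot.lift` through ★ Q1's
`e : F_v[X]⁄(X² − d) ≃ K₁`), `s̃ s̃ = id`, `s̃ 𝒪 ⊆ 𝒪`; and the `F_v`-linear involution `ι′` has `ι′ θ = −θ`. [cite: Lang2002, Ch. V §1] [cite: SerreLocalFields1979, Ch. I §6] -/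
theorem exists_involutions_of_ramified (s : v.adicCompletion F →+* v.adicCompletion F) (hss : ∀ x, s (s x) = x) (hsd : s d = d)
    (hsO : ∀ x : 𝒪[v.adicCompletion F], s x ∈ 𝒪[v.adicCompletion F])
    {θ : w.1.adicCompletion E} (hθ : θ ^ 2 = toPlace v w d) :
    (∃ s' : w.1.adicCompletion E →+* w.1.adicCompletion E,
      (∀ x, s' (toPlace v w x) = toPlace v w (s x)) ∧ s' θ = θ ∧ (∀ z, s' (s' z) = z) ∧
      (∀ z : 𝒪[w.1.adicCompletion E], s' z ∈ 𝒪[w.1.adicCompletion E])) ∧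
    (∃ ι' : w.1.adicCompletion E →+* w.1.adicCompletion E,
      (∀ x, ι' (toPlace v w x) = toPlace v w x) ∧ ι' θ = -θ ∧ (∀ z, ι' (ι' z) = z) ∧
      (∀ z : 𝒪[w.1.adicCompletion E], ι' z ∈ 𝒪[w.1.adicCompletion E])) := by
  have hns : ¬ IsSquare d := not_isSquare_of_valued_eq_exp_neg_one v hd
  have he : v.asIdeal.ramificationIdx' w.1.asIdeal = 2 := ramificationIdx'_eq_two_of_uniformizer E v σ hσδ hδ hm hd hdm w
  have hθv : Valued.v θ = WithZero.exp (-1 : ℤ) := valued_eq_exp_neg_one_of_sq_eq_toPlace E v w he hθ hd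
  set ι := toPlace v w with hιdef
  -- coordinates and integrality in the Eisenstein basis `(1, θ)`
  have hcoord : ∀ z : w.1.adicCompletion E, ∃ pq : v.adicCompletion F × v.adicCompletion F, z = ι pq.1 + ι pq.2 * θ := fun z =>
    (existsUnique_eq_toPlace_add_toPlace_mul_of_sq_eq E v σ hσδ hδ hm hns hdm w hθ z).exists
  have hint : ∀ p q : v.adicCompletion F, ι p + ι q * θ ∈ 𝒪[w.1.adicCompletion E] ↔ p ∈ 𝒪[v.adicCompletion F] ∧ q ∈ 𝒪[v.adicCompletion F] := by
    intro p q
    rw [hιdef, toPlace_add_toPlace_mul_mem_integer_iff_of_ramified E v w he hθv, mem_integer_iff_valued_le_one, mem_integer_iff_valued_le_one]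
  -- the isomorphism `e : F_v[X]⁄(X² − d) ≃ E_w` through `θ`
  obtain ⟨e, he_of, he_root⟩ := exists_ringEquiv_adjoinRoot_of_sq_eq E v σ hσδ hδ hm hd hdm w hθ
  have hsymm_of : ∀ x, e.symm (ι x) = AdjoinRoot.of (X ^ 2 - C d) x := fun x => by
    rw [hιdef, ← he_of, RingEquiv.symm_apply_apply]
  have hsymm_root : e.symm θ = AdjoinRoot.root (X ^ 2 - C d) := by rw [← he_root, RingEquiv.symm_apply_apply]
  refine ⟨?_, ?_⟩
  · -- `s̃ := lift (ι ∘ s) θ ∘ e⁻¹`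
    have hroot : (X ^ 2 - C d).eval₂ (ι.comp s) θ = 0 := by
      rw [eval₂_sub, eval₂_X_pow, eval₂_C, RingHom.comp_apply, hsd, hθ, hιdef, sub_self]
    let ψ : AdjoinRoot (X ^ 2 - C d) →+* w.1.adicCompletion E := AdjoinRoot.lift (ι.comp s) θ hroot
    let s' : w.1.adicCompletion E →+* w.1.adicCompletion E := ψ.comp e.symm.toRingHom
    have hs'ι : ∀ x, s' (ι x) = ι (s x) := fun x => by
      change ψ (e.symm (ι x)) = ι (s x)
      rw [hsymm_of, AdjoinRoot.lift_of, RingHom.comp_apply]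
    have hs'θ : s' θ = θ := by
      change ψ (e.symm θ) = θ
      rw [hsymm_root, AdjoinRoot.lift_root]
    have hs'pq : ∀ p q : v.adicCompletion F, s' (ι p + ι q * θ) = ι (s p) + ι (s q) * θ := fun p q => by
      rw [map_add, map_mul, hs'ι, hs'ι, hs'θ]
    refine ⟨s', fun x => hs'ι x, hs'θ, fun z => ?_, fun z => ?_⟩
    · obtain ⟨pq, rfl⟩ := hcoord z
      rw [hs'pq, hs'pq, hss, hss]
    · obtain ⟨pq, hpq⟩ := hcoord z
      have hmem := z.2
      rw [hpq, hint] at hmem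
      change s' (z : w.1.adicCompletion E) ∈ 𝒪[w.1.adicCompletion E]
      rw [hpq, hs'pq, hint]
      exact ⟨hsO ⟨pq.1, hmem.1⟩, hsO ⟨pq.2, hmem.2⟩⟩
  · -- `ι′ := lift ι (−θ) ∘ e⁻¹`
    have hroot : (X ^ 2 - C d).eval₂ ι (-θ) = 0 := by
      rw [eval₂_sub, eval₂_X_pow, eval₂_C, neg_sq, hθ, hιdef, sub_self]
    let ψ : AdjoinRoot (X ^ 2 - C d) →+* w.1.adicCompletion E := AdjoinRoot.lift ι (-θ) hroot
    let ι' : w.1.adicCompletion E →+* w.1.adicCompletion E := ψ.comp e.symm.toRingHom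
    have hι'ι : ∀ x, ι' (ι x) = ι x := fun x => by
      change ψ (e.symm (ι x)) = ι x
      rw [hsymm_of, AdjoinRoot.lift_of]
    have hι'θ : ι' θ = -θ := by
      change ψ (e.symm θ) = -θ
      rw [hsymm_root, AdjoinRoot.lift_root]
    have hι'pq : ∀ p q : v.adicCompletion F, ι' (ι p + ι q * θ) = ι p + ι (-q) * θ := fun p q => by
      rw [map_add, map_mul, hι'ι, hι'ι, hι'θ, map_neg]; ring
    refine ⟨ι', fun x => hι'ι x, hι'θ, fun z => ?_, fun z => ?_⟩
    · obtain ⟨pq, rfl⟩ := hcoord z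
      rw [hι'pq, hι'pq, neg_neg]
    · obtain ⟨pq, hpq⟩ := hcoord z
      have hmem := z.2
      rw [hpq, hint] at hmem
      change ι' (z : w.1.adicCompletion E) ∈ 𝒪[w.1.adicCompletion E]
      rw [hpq, hι'pq, hint]
      exact ⟨hmem.1, neg_mem hmem.2⟩

/-! ## §3 (L3) Unit norms onto for `s̃`: `K₁ ∕ K₁^{s̃}` is unramified -/

omit [Algebra.IsQuadraticExtension F E] in
/-- **(L3) UNIT NORMS ONTO FOR `s̃`** (`K₁ ∕ K₁^{s̃}` is unramified: `s̃` moves the integer `ι₁ a` by the unit `ι₁ (s a − a)`; ★ `exists_mul_map_eq_of_isUnit_integer`).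
[cite: SerreLocalFields1979, Ch. V §2 Prop. 3 and Corollary] -/
theorem exists_mul_map_eq_of_ramified (s : v.adicCompletion F →+* v.adicCompletion F)
    (hmove : ∃ a : 𝒪[v.adicCompletion F], IsUnit a ∧ s a - a ∈ 𝒪[v.adicCompletion F] ∧ ∃ b : 𝒪[v.adicCompletion F], (b : v.adicCompletion F) * (s a - a) = 1)
    (s' : w.1.adicCompletion E →+* w.1.adicCompletion E) (hs' : ∀ x, s' (toPlace v w x) = toPlace v w (s x)) (hs's' : ∀ z, s' (s' z) = z)
    (hs'O : ∀ z : 𝒪[w.1.adicCompletion E], s' z ∈ 𝒪[w.1.adicCompletion E])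
    (u : 𝒪[w.1.adicCompletion E]) (hu : IsUnit u) (hsu : s' u = u) :
    ∃ t : 𝒪[w.1.adicCompletion E], (t : w.1.adicCompletion E) * s' t = u := by
  obtain ⟨a, -, -, b, hb⟩ := hmove
  -- `s̃` moves the integer `ι₁ a` by `ι₁ (s a − a)`, a unit of `𝒪[E_w]` with inverse `ι₁ b`
  have hmove' : ∃ a' : 𝒪[w.1.adicCompletion E], IsUnit ((⟨s' a', hs'O a'⟩ : 𝒪[w.1.adicCompletion E]) - a') := by
    refine ⟨⟨toPlace v w a, toPlace_mem_integer_of_mem_integer E v w a.2⟩, ?_⟩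
    refine IsUnit.of_mul_eq_one ⟨toPlace v w b, toPlace_mem_integer_of_mem_integer E v w b.2⟩ (Subtype.ext ?_)
    change (s' (toPlace v w a) - toPlace v w a) * toPlace v w b = 1
    rw [hs', ← map_sub, ← map_mul, mul_comm, hb, map_one]
  exact Literature.NumberTheory.LocalFields.UnramifiedQuadraticNorm.exists_mul_map_eq_of_isUnit_integer s' hs's' hs'O hmove' u hu hsu

end Literature.NumberTheory.NumberFields

end
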